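import Summits.CriticalPhenomena.PercolationContinuityZ3.Theorems.Transplant.GrigorchukSubexponentialGrowthAllGens
import Mathlib.GroupTheory.Index
import Mathlib.GroupTheory.QuotientGroup.Basic
import HarnessLib

/-!
# SECTION LIFTS WITH LINEAR WORD LENGTH in the first Grigorchuk group: every element of the finite-index subgroup `R = φ₀(ristG 0) = φ₁(ristG 1)`
# of word length `≤ n` lifts to BOTH level-one rigid stabilisers with word length `≤ L·n` (Schreier rewriting), and `|B(n)| ≤ T·|R ∩ B(n + c)|`

builds on p205010 (kernel theorem, internal audit signed; external expert review pending) — nothing in this file uses p205010; pure group theory / counting,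
no percolation statement, no node touched.  Lane `prim-bschramm`, seat `prim-bschramm-gen-1` gen 8 (GEN pen; offer O-GR2 file H1, lead g25 GO 2026-08-28T07:42Z).
DEFINITION LANE (review-queued): `Letter.toG` (the four letters as elements of `Γ = ↥grigorchukGroup`), the explicit word lists `wordsLe` and the word-length balls
`wordBall n : Finset Γ`; everything else is theorems (existential: the constants `L`, `T`, `c` are produced, not named).  Helper file
(`--supports stmt-CriticalPhenomena-4575 --as helper`).  No instance, no notation; REUSES F-MP1 p606245 («GrigorchukRigidStabilizers»: `rist`, `ristG`, `secR`,
`sec_not_eq_one`, `range_secR_finiteIndex`), p590401 (`sec`, `sec_conj_genA`), G4 p613200 (`exists_word_of_mem`, `prod_reverse`, `Letter.toPerm_mul_self`).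
NOTHING about growth RATES is concluded here (that is H2 «GrigorchukSuperpolynomialGrowth»); 'intermediate growth' stays MUST-NOT until H2 lands.

* §1 `Letter.toG`, `wordsLe`, **`wordBall n`** with `mem_wordBall : g ∈ wordBall n ↔ ∃ w, |w| ≤ n ∧ Π w = g`; monotone, `1 ∈`, closed under products
  (`wordBall m * wordBall n ⊆ wordBall (m+n)`) and inverses.
* §2 `range_secR_true_eq : range φ₁ = range φ₀` (conjugation by `a` swaps the rigid stabilisers and the sections).
* §3 SCHREIER REWRITING for `R := range φ₀` (finite index, F-MP1): a coset-representative function through the finite quotient `Γ ⧸ R`, the finite set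
  `Sg = {(r(ℓ t))⁻¹ ℓ t} ⊆ R`, and: every `x ∈ R ∩ wordBall n` is a product of `≤ n` elements of `Sg`; **`card_wordBall_le : |wordBall n| ≤ T·|R ∩ wordBall (n + c)|`**.
* §4 **`exists_section_lifts : ∃ L, ∀ i n x, x ∈ R → x ∈ wordBall n → ∃ g ∈ rist i (in Γ), φᵢ(g) = x ∧ g ∈ wordBall (L·n)`** — lifts with LINEAR length.
[cite: Grigorchuk1984, proof of the lower bound (𝔊 is commensurable with 𝔊 × 𝔊)] [cite: LyonsPeres2016, §7.2 (finite-index subgroups: Schreier generators,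
word metrics bi-Lipschitz)] [cite: BartholdiErschler2012, §3.1 (ψ, St(1))]
-/

noncomputable section

namespace Summit.CriticalPhenomena.PercolationContinuityZ3.Theorems.Transplant

namespace Grigorchuk

open scoped Classical

/-! ## §1 Letters in `Γ`, words, word-length balls -/

/-- The four letters as elements of `Γ = ↥grigorchukGroup` (F-MP1's `aG bG cG dG`). [cite: Grigorchuk1980, definition of the group] -/
def Letter.toG : Letter → ↥grigorchukGroup
  | .a => aG
  | .x .b => bG
  | .x .c => cG
  | .x .d => dG

/-- Underlying permutation of a letter. [folklore] -/
theorem Letter.coe_toG (ℓ : Letter) : ((ℓ.toG : ↥grigorchukGroup) : Equiv.Perm Ray) = ℓ.toPerm := by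
  rcases ℓ with _ | ⟨_ | _ | _⟩ <;> rfl

/-- Underlying permutation of a word. [folklore] -/
theorem coe_prod_toG (w : List Letter) : (((w.map Letter.toG).prod : ↥grigorchukGroup) : Equiv.Perm Ray) = (w.map Letter.toPerm).prod := by
  induction w with
  | nil => rfl
  | cons ℓ w ih => rw [List.map_cons, List.map_cons, List.prod_cons, List.prod_cons, Subgroup.coe_mul, ih, Letter.coe_toG]

/-- A letter is an involution in `Γ`. [cite: Grigorchuk1980, a² = b² = c² = d² = 1] -/
theorem Letter.toG_mul_self (ℓ : Letter) : ℓ.toG * ℓ.toG = 1 :=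
  Subtype.ext (by rw [Subgroup.coe_mul, Letter.coe_toG]; exact Letter.toPerm_mul_self ℓ)

/-- The reversed word is the inverse, in `Γ`. [folklore] -/
theorem prod_toG_reverse (w : List Letter) : (w.reverse.map Letter.toG).prod = ((w.map Letter.toG).prod)⁻¹ :=
  Subtype.ext (by rw [Subgroup.coe_inv, coe_prod_toG, coe_prod_toG, prod_reverse])

/-- **Every element of `Γ` is a word** (G4's `exists_word_of_mem`, read in `Γ`). [cite: Grigorchuk1980, definition of the group] -/
theorem exists_wordG (g : ↥grigorchukGroup) : ∃ w : List Letter, (w.map Letter.toG).prod = g := by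
  obtain ⟨w, hw⟩ := exists_word_of_mem g.2
  exact ⟨w, Subtype.ext (by rw [coe_prod_toG, hw])⟩

/-- All words of length `≤ k` (explicit enumeration). [folklore] -/
def wordsLe : ℕ → List (List Letter)
  | 0 => [[]]
  | k + 1 => [] :: (wordsLe k).flatMap fun w => [Letter.a :: w, Letter.x .b :: w, Letter.x .c :: w, Letter.x .d :: w]

/-- `wordsLe k` contains every word of length `≤ k`. [folklore] -/
theorem mem_wordsLe : ∀ (k : ℕ) (w : List Letter), w.length ≤ k → w ∈ wordsLe k
  | 0, w, h => by
    have hw : w = [] := List.length_eq_zero_iff.1 (Nat.le_zero.1 h)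
    subst hw; simp [wordsLe]
  | k + 1, [], _ => by simp [wordsLe]
  | k + 1, ℓ :: w, h => by
    have ih := mem_wordsLe k w (by simp only [List.length_cons] at h; omega)
    simp only [wordsLe, List.mem_cons, List.mem_flatMap]
    refine Or.inr ⟨w, ih, ?_⟩
    rcases ℓ with _ | ⟨_ | _ | _⟩ <;> simp

/-- Words in `wordsLe k` have length `≤ k`. [folklore] -/
theorem length_le_of_mem_wordsLe : ∀ (k : ℕ) (w : List Letter), w ∈ wordsLe k → w.length ≤ k
  | 0, w, h => by simp [wordsLe] at h; subst h; simp
  | k + 1, w, h => by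
    simp only [wordsLe, List.mem_cons, List.mem_flatMap] at h
    rcases h with rfl | ⟨w', hw', h⟩
    · simp
    · have := length_le_of_mem_wordsLe k w' hw'
      simp only [List.mem_nil_iff, or_false] at h
      rcases h with rfl | rfl | rfl | rfl <;> simp <;> omega

/-- **The word-length ball**: elements of `Γ` that are words of `≤ n` letters. [cite: LyonsPeres2016, §7.2 (word metric)] -/
def wordBall (n : ℕ) : Finset ↥grigorchukGroup := ((wordsLe n).map fun w => (w.map Letter.toG).prod).toFinset

/-- **Membership in the word ball.** [folklore] -/
theorem mem_wordBall {n : ℕ} {g : ↥grigorchukGroup} : g ∈ wordBall n ↔ ∃ w : List Letter, w.length ≤ n ∧ (w.map Letter.toG).prod = g := by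
  simp only [wordBall, List.mem_toFinset, List.mem_map]
  constructor
  · rintro ⟨w, hw, rfl⟩; exact ⟨w, length_le_of_mem_wordsLe n w hw, rfl⟩
  · rintro ⟨w, hw, rfl⟩; exact ⟨w, mem_wordsLe n w hw, rfl⟩

/-- `wordBall` is monotone. [folklore] -/
theorem wordBall_mono {m n : ℕ} (h : m ≤ n) : wordBall m ⊆ wordBall n := fun g hg => by
  obtain ⟨w, hw, e⟩ := mem_wordBall.1 hg
  exact mem_wordBall.2 ⟨w, hw.trans h, e⟩

/-- `1 ∈ wordBall n`. [folklore] -/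
theorem one_mem_wordBall (n : ℕ) : (1 : ↥grigorchukGroup) ∈ wordBall n := mem_wordBall.2 ⟨[], by simp, by simp⟩

/-- Products: `wordBall m · wordBall n ⊆ wordBall (m + n)`. [folklore] -/
theorem mul_mem_wordBall {m n : ℕ} {g h : ↥grigorchukGroup} (hg : g ∈ wordBall m) (hh : h ∈ wordBall n) : g * h ∈ wordBall (m + n) := by
  obtain ⟨u, hu, rfl⟩ := mem_wordBall.1 hg
  obtain ⟨v, hv, rfl⟩ := mem_wordBall.1 hh
  exact mem_wordBall.2 ⟨u ++ v, by rw [List.length_append]; omega, by rw [List.map_append, List.prod_append]⟩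

/-- Inverses: `(wordBall n)⁻¹ = wordBall n`. [folklore] -/
theorem inv_mem_wordBall {n : ℕ} {g : ↥grigorchukGroup} (hg : g ∈ wordBall n) : g⁻¹ ∈ wordBall n := by
  obtain ⟨u, hu, rfl⟩ := mem_wordBall.1 hg
  exact mem_wordBall.2 ⟨u.reverse, by rw [List.length_reverse]; exact hu, prod_toG_reverse u⟩

/-- Every element of `Γ` lies in some word ball. [folklore] -/
theorem exists_mem_wordBall (g : ↥grigorchukGroup) : ∃ n, g ∈ wordBall n := by
  obtain ⟨w, hw⟩ := exists_wordG g
  exact ⟨w.length, mem_wordBall.2 ⟨w, le_rfl, hw⟩⟩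

/-! ## §2 The two section ranges coincide -/

/-- Conjugation by `a` carries `ristG i` to `ristG ¬i`. [cite: BartholdiErschler2012, §3.1 (a swaps the two subtrees)] -/
theorem conj_aG_mem_ristG {i : Bool} {g : ↥grigorchukGroup} (hg : g ∈ ristG i) : aG * g * aG ∈ ristG (!i) := by
  have hg' : (g : Equiv.Perm Ray) ∈ rist i := hg
  intro x hx
  have hx' : (genA x) 0 ≠ i := by rw [genA_apply_zero]; cases h : x 0 <;> cases i <;> simp_all
  have hfix : (g : Equiv.Perm Ray) (genA x) = genA x := hg' (genA x) hx'
  show (genA * (g : Equiv.Perm Ray) * genA) x = x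
  rw [Equiv.Perm.mul_apply, Equiv.Perm.mul_apply, hfix]
  exact flipAt_involutive 0 x

/-- … with the section carried along: `φ_{¬i}(a g a) = φ_i(g)`. [cite: BartholdiErschler2012, §3.1 (ψ(a g a) swaps)] -/
theorem sec_conj_aG {i : Bool} {g : ↥grigorchukGroup} (hg : g ∈ ristG i) :
    sec (!i) ⟨((aG * g * aG : ↥grigorchukGroup) : Equiv.Perm Ray), rist_le_stabOne (!i) (conj_aG_mem_ristG hg)⟩ =
      sec i ⟨(g : Equiv.Perm Ray), rist_le_stabOne i hg⟩ := by
  have e : (⟨((aG * g * aG : ↥grigorchukGroup) : Equiv.Perm Ray), rist_le_stabOne (!i) (conj_aG_mem_ristG hg)⟩ : ↥stabOne) =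
      ⟨genA * ((⟨(g : Equiv.Perm Ray), rist_le_stabOne i hg⟩ : ↥stabOne) : Equiv.Perm Ray) * genA, conj_genA_mem_stabOne (rist_le_stabOne i hg)⟩ := rfl
  rw [e, sec_conj_genA, Bool.not_not]

/-- **`range φ₁ = range φ₀`**: the two rigid stabilisers have the same section image `R ≤ Γ`. [cite: BartholdiErschler2012, §3.1] -/
theorem range_secR_eq (i : Bool) : (secR i).range = (secR (!i)).range := by
  have key : ∀ j : Bool, (secR j).range ≤ (secR (!j)).range := by
    intro j x hx
    obtain ⟨g, rfl⟩ := hx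
    refine ⟨⟨aG * (g : ↥grigorchukGroup) * aG, conj_aG_mem_ristG g.2⟩, Subtype.ext ?_⟩
    rw [coe_secR, coe_secR]
    exact sec_conj_aG g.2
  refine le_antisymm (key i) ?_
  have h := key (!i)
  rwa [Bool.not_not] at h

/-! ## §3 Schreier rewriting for `R = range φ₀` -/

/-- **Coset representatives**: a function `r : Γ → Γ` with finite image, constant on left cosets of `R = range φ₀`, `r g ∈ g R`, `r 1 = 1`.
[cite: LyonsPeres2016, §7.2 (finite-index subgroups)] -/
theorem exists_reps : ∃ (T : Finset ↥grigorchukGroup) (r : ↥grigorchukGroup → ↥grigorchukGroup),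
    (∀ g, r g ∈ T) ∧ (∀ g, (r g)⁻¹ * g ∈ (secR false).range) ∧ (∀ g h, g⁻¹ * h ∈ (secR false).range → r g = r h) ∧ r 1 = 1 := by
  set R := (secR false).range with hR
  haveI : R.FiniteIndex := range_secR_finiteIndex false
  haveI : Finite (↥grigorchukGroup ⧸ R) := Subgroup.finite_quotient_of_finiteIndex
  letI : Fintype (↥grigorchukGroup ⧸ R) := Fintype.ofFinite _
  let ρ : ↥grigorchukGroup ⧸ R → ↥grigorchukGroup := fun q => if q = ((1 : ↥grigorchukGroup) : ↥grigorchukGroup ⧸ R) then 1 else Quotient.out q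
  have hρ : ∀ q : ↥grigorchukGroup ⧸ R, (ρ q : ↥grigorchukGroup ⧸ R) = q := by
    intro q
    by_cases h : q = ((1 : ↥grigorchukGroup) : ↥grigorchukGroup ⧸ R)
    · have e : ρ q = 1 := if_pos h
      rw [e, h]
    · have e : ρ q = Quotient.out q := if_neg h
      rw [e]; exact QuotientGroup.out_eq' q
  refine ⟨Finset.univ.image ρ, fun g => ρ (g : ↥grigorchukGroup ⧸ R), fun g => Finset.mem_image_of_mem ρ (Finset.mem_univ _), fun g => ?_,
    fun g h hgh => ?_, ?_⟩
  · rw [← QuotientGroup.eq, hρ]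
  · have : ((g : ↥grigorchukGroup ⧸ R)) = (h : ↥grigorchukGroup ⧸ R) := QuotientGroup.eq.2 hgh
    simp only [this]
  · simp only [ρ, if_pos rfl]

/-- **SCHREIER REWRITING**: with representatives as above there is a finite `Sg ⊆ R` such that for every word `w`, `(r (Π w))⁻¹ · Π w` is a product of
exactly `|w|` elements of `Sg`. [cite: LyonsPeres2016, §7.2 (Schreier generators)] -/
theorem schreier_rewrite {T : Finset ↥grigorchukGroup} {r : ↥grigorchukGroup → ↥grigorchukGroup} (hT : ∀ g, r g ∈ T)
    (hR : ∀ g, (r g)⁻¹ * g ∈ (secR false).range) (hconst : ∀ g h, g⁻¹ * h ∈ (secR false).range → r g = r h) (h1 : r 1 = 1) :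
    ∃ Sg : Finset ↥grigorchukGroup, (∀ σ ∈ Sg, σ ∈ (secR false).range) ∧
      ∀ w : List Letter, ∃ σs : List ↥grigorchukGroup, σs.length = w.length ∧ (∀ σ ∈ σs, σ ∈ Sg) ∧
        (r (w.map Letter.toG).prod)⁻¹ * (w.map Letter.toG).prod = σs.prod := by
  let Ls : Finset Letter := {Letter.a, Letter.x .b, Letter.x .c, Letter.x .d}
  have hLs : ∀ ℓ : Letter, ℓ ∈ Ls := by intro ℓ; rcases ℓ with _ | ⟨_ | _ | _⟩ <;> simp [Ls]
  let Sg : Finset ↥grigorchukGroup := (T ×ˢ Ls).image fun p => (r (p.2.toG * p.1))⁻¹ * (p.2.toG * p.1)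
  refine ⟨Sg, fun σ hσ => ?_, fun w => ?_⟩
  · obtain ⟨p, -, rfl⟩ := Finset.mem_image.1 hσ
    exact hR _
  · induction w with
    | nil => exact ⟨[], rfl, fun _ h => by simp at h, by simp [h1]⟩
    | cons ℓ w ih =>
      obtain ⟨σs, hlen, hmem, hprod⟩ := ih
      set q' : ↥grigorchukGroup := (w.map Letter.toG).prod with hq'
      have hq : ((ℓ :: w).map Letter.toG).prod = ℓ.toG * q' := by rw [List.map_cons, List.prod_cons]
      refine ⟨((r (ℓ.toG * q'))⁻¹ * (ℓ.toG * r q')) :: σs, by rw [List.length_cons, List.length_cons, hlen], ?_, ?_⟩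
      · intro σ hσ
        rw [List.mem_cons] at hσ
        rcases hσ with rfl | hσ
        · -- `r (ℓ q') = r (ℓ r(q'))` by coset-invariance
          have hc : r (ℓ.toG * q') = r (ℓ.toG * r q') := by
            refine hconst _ _ ?_
            have e : (ℓ.toG * q')⁻¹ * (ℓ.toG * r q') = ((r q')⁻¹ * q')⁻¹ := by group
            rw [e]; exact Subgroup.inv_mem _ (hR q')
          rw [hc]
          exact Finset.mem_image.2 ⟨(r q', ℓ), Finset.mem_product.2 ⟨hT q', hLs ℓ⟩, rfl⟩
        · exact hmem σ hσ
      · rw [hq, List.prod_cons, ← hprod]; group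

/-- **`|wordBall n| ≤ T · |R ∩ wordBall (n + c)|`**: `g ↦ (r g)⁻¹ g ∈ R` has word length `≤ n + c` (`c` bounds the representatives) and is injective on each of
the `T` fibres `{r g = t}`. [cite: LyonsPeres2016, §7.2 (finite-index subgroups)] -/
theorem card_wordBall_le : ∃ T c : ℕ, 0 < T ∧ ∀ n : ℕ,
    (wordBall n).card ≤ T * ((wordBall (n + c)).filter fun x => x ∈ (secR false).range).card := by
  obtain ⟨T, r, hT, hR, hconst, h1⟩ := exists_reps
  -- a uniform word length for the inverses of the representatives
  have hc : ∃ c : ℕ, ∀ t ∈ T, t⁻¹ ∈ wordBall c := by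
    choose f hf using fun t : ↥grigorchukGroup => exists_mem_wordBall t⁻¹
    exact ⟨T.sup f, fun t ht => wordBall_mono (Finset.le_sup ht) (hf t)⟩
  obtain ⟨c, hc⟩ := hc
  refine ⟨T.card, c, Finset.card_pos.2 ⟨r 1, hT 1⟩, fun n => ?_⟩
  -- fibrewise: `wordBall n = ⋃_{t ∈ T} {g | r g = t}`
  have hcover : wordBall n = T.biUnion fun t => (wordBall n).filter fun g => r g = t := by
    ext g
    simp only [Finset.mem_biUnion, Finset.mem_filter]
    exact ⟨fun hg => ⟨r g, hT g, hg, rfl⟩, fun ⟨_, _, hg, _⟩ => hg⟩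
  rw [hcover]
  refine (Finset.card_biUnion_le).trans ?_
  calc ∑ t ∈ T, ((wordBall n).filter fun g => r g = t).card
      ≤ ∑ _t ∈ T, ((wordBall (n + c)).filter fun x => x ∈ (secR false).range).card := by
        refine Finset.sum_le_sum fun t ht => ?_
        refine Finset.card_le_card_of_injOn (fun g => (r g)⁻¹ * g) (fun g hg => ?_) (fun g hg g' hg' e => ?_)
        · rw [Finset.mem_coe, Finset.mem_filter] at hg
          obtain ⟨hgw, hgt⟩ := hg
          show (r g)⁻¹ * g ∈ ((wordBall (n + c)).filter fun x => x ∈ (secR false).range)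
          rw [Finset.mem_filter]
          refine ⟨?_, hR g⟩
          rw [hgt, show n + c = c + n by omega]
          exact mul_mem_wordBall (hc t ht) hgw
        · rw [Finset.mem_coe, Finset.mem_filter] at hg hg'
          have e' : (r g)⁻¹ * g = (r g')⁻¹ * g' := e
          rw [hg.2, hg'.2] at e'
          exact mul_left_cancel e'
    _ = T.card * ((wordBall (n + c)).filter fun x => x ∈ (secR false).range).card := by rw [Finset.sum_const, smul_eq_mul]

/-! ## §4 Lifts with linear word length -/

/-- **SECTION LIFTS WITH LINEAR LENGTH**: there is `L` such that every `x ∈ R = range φ₀` of word length `≤ n` is `φᵢ(g)` for some `g` in the rigid stabiliser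
`rist i` (inside `Γ`) of word length `≤ L·n`, for both `i`. [cite: Grigorchuk1984, proof of the lower bound] [cite: LyonsPeres2016, §7.2] -/
theorem exists_section_lifts : ∃ L : ℕ, ∀ (i : Bool) (n : ℕ) (x : ↥grigorchukGroup), x ∈ (secR false).range → x ∈ wordBall n →
    ∃ g : ↥grigorchukGroup, ∃ hg : (g : Equiv.Perm Ray) ∈ rist i,
      sec i ⟨(g : Equiv.Perm Ray), rist_le_stabOne i hg⟩ = (x : Equiv.Perm Ray) ∧ g ∈ wordBall (L * n) := by
  obtain ⟨T, r, hT, hR, hconst, h1⟩ := exists_reps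
  obtain ⟨Sg, hSgR, hrew⟩ := schreier_rewrite hT hR hconst h1
  -- every `σ ∈ Sg` has a preimage in `ristG i`, for both `i`, with a word; take a uniform bound `L`
  have hpre : ∀ (i : Bool) (σ : ↥grigorchukGroup), σ ∈ Sg → ∃ g : ↥grigorchukGroup, ∃ hg : (g : Equiv.Perm Ray) ∈ rist i,
      sec i ⟨(g : Equiv.Perm Ray), rist_le_stabOne i hg⟩ = (σ : Equiv.Perm Ray) := by
    intro i σ hσ
    have hσi : σ ∈ (secR i).range := by
      cases i
      · exact hSgR σ hσ
      · rw [range_secR_eq true]; exact hSgR σ hσ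
    obtain ⟨g, hg⟩ := hσi
    exact ⟨(g : ↥grigorchukGroup), g.2, by rw [← hg, coe_secR]⟩
  have hL : ∃ L : ℕ, ∀ (i : Bool) (σ : ↥grigorchukGroup), σ ∈ Sg → ∃ g : ↥grigorchukGroup, ∃ hg : (g : Equiv.Perm Ray) ∈ rist i,
      sec i ⟨(g : Equiv.Perm Ray), rist_le_stabOne i hg⟩ = (σ : Equiv.Perm Ray) ∧ g ∈ wordBall L := by
    choose G hG hsec using hpre
    choose N hN using fun (i : Bool) (σ : ↥grigorchukGroup) (hσ : σ ∈ Sg) => exists_mem_wordBall (G i σ hσ)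
    refine ⟨(Sg.attach.sup fun σ => N false σ.1 σ.2) + (Sg.attach.sup fun σ => N true σ.1 σ.2), fun i σ hσ => ⟨G i σ hσ, hG i σ hσ, hsec i σ hσ, ?_⟩⟩
    refine wordBall_mono ?_ (hN i σ hσ)
    cases i
    · exact le_add_right (Finset.le_sup (f := fun σ : {σ // σ ∈ Sg} => N false σ.1 σ.2) (Finset.mem_attach Sg ⟨σ, hσ⟩))
    · exact le_add_left (Finset.le_sup (f := fun σ : {σ // σ ∈ Sg} => N true σ.1 σ.2) (Finset.mem_attach Sg ⟨σ, hσ⟩))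
  obtain ⟨L, hL⟩ := hL
  refine ⟨L, fun i n x hx hxn => ?_⟩
  -- lift a list of `Sg`-elements factor by factor
  have hlist : ∀ σs : List ↥grigorchukGroup, (∀ σ ∈ σs, σ ∈ Sg) → ∃ g : ↥grigorchukGroup, ∃ hg : (g : Equiv.Perm Ray) ∈ rist i,
      sec i ⟨(g : Equiv.Perm Ray), rist_le_stabOne i hg⟩ = (σs.prod : Equiv.Perm Ray) ∧ g ∈ wordBall (L * σs.length) := by
    intro σs
    induction σs with
    | nil =>
      intro _
      refine ⟨1, (rist i).one_mem, ?_, by simpa using one_mem_wordBall 0⟩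
      rw [show (⟨((1 : ↥grigorchukGroup) : Equiv.Perm Ray), rist_le_stabOne i (rist i).one_mem⟩ : ↥stabOne) = 1 from rfl, map_one]; rfl
    | cons σ σs ih =>
      intro hall
      obtain ⟨g₁, hg₁, hs₁, hw₁⟩ := hL i σ (hall σ (by simp))
      obtain ⟨g₂, hg₂, hs₂, hw₂⟩ := ih fun τ hτ => hall τ (by simp [hτ])
      refine ⟨g₁ * g₂, (rist i).mul_mem hg₁ hg₂, ?_, ?_⟩
      · have e : (⟨((g₁ * g₂ : ↥grigorchukGroup) : Equiv.Perm Ray), rist_le_stabOne i ((rist i).mul_mem hg₁ hg₂)⟩ : ↥stabOne) =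
            ⟨(g₁ : Equiv.Perm Ray), rist_le_stabOne i hg₁⟩ * ⟨(g₂ : Equiv.Perm Ray), rist_le_stabOne i hg₂⟩ := rfl
        rw [e, map_mul, hs₁, hs₂, List.prod_cons, Subgroup.coe_mul]
      · rw [List.length_cons, Nat.mul_succ, add_comm]
        exact mul_mem_wordBall hw₁ hw₂
  obtain ⟨w, hw, hwx⟩ := mem_wordBall.1 hxn
  obtain ⟨σs, hlen, hmem, hprod⟩ := hrew w
  have hrx : r x = 1 := by
    rw [← h1]
    refine hconst _ _ ?_
    rw [mul_one]
    exact Subgroup.inv_mem _ hx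
  rw [hwx, hrx, inv_one, one_mul] at hprod
  obtain ⟨g, hg, hs, hwg⟩ := hlist σs hmem
  refine ⟨g, hg, by rw [hs, ← hprod], wordBall_mono (by rw [hlen]; exact Nat.mul_le_mul_left L hw) hwg⟩

end Grigorchuk

end Summit.CriticalPhenomena.PercolationContinuityZ3.Theorems.Transplant

end
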